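import Literature.NumberTheory.ComplexMultiplication.TateHalfTransferOrbits
import Literature.NumberTheory.ComplexMultiplication.ReflexNormIdelesOrbits
import Literature.NumberTheory.ComplexMultiplication.TateHalfTransferCM
import Literature.NumberTheory.NumberFields.PrincipalIdealTheorem
import HarnessLib

/-!
# `F_j(σ) = σ_j⁻¹ V(σ) σ_j` read in `Gal(E^ab/E)`: the half transfer over a `Γ_k`-orbit is `res_{E}^{σ_jL_j} ∘ Ver_{σ_jL_j/k}`
# (Milne, *The fundamental theorem of complex multiplication*, arXiv:0705.3446, §4.2, proof of Proposition 4.9 — the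
# Galois side)

Topic `NumberTheory/ComplexMultiplication`; namespace `Literature.NumberTheory.ComplexMultiplication`.  Lane
`lit-hodgefound` (Track 2, Layer A3 skeleton seat `skel-3`, row A3-G46 FILE 3 of 4/5: the bottom row
«`Gal(E*^ab/E*) →^V σ_jGal(L_j^ab/L_j)σ_j⁻¹ →^{ad σ_j⁻¹} Gal(L_j^ab/L_j) →^{restriction} Gal(E^ab/E)`» of Milne's diagram in the
proof of Prop. 4.9, and «`F_j(σ) = σ_j⁻¹V(σ)σ_j`» as an identity in `Gal(E^ab/E)`, in the tree's `Γ_ℚ`-parametrisation of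
row A3-G45 (`…/TateHalfTransferCM`).  FILE 1 `…/TateHalfTransferOrbits` is the abstract group theory, FILE 2
`…/ReflexNormIdelesOrbits` the idelic orbit decomposition «`N_Φ(a) = ∏ b_j`», FILE 4 `…/TateHalfTransferReflexNorm` sums over
the orbits and passes to idèles («`art_E(N_Φ(a)) = F_Φ(σ)`»), FILE 5 `…/TaniyamaElementReflexNorm` is Prop. 4.9.)
Definitions with bodies (`orbitEmbedding`, `orbitGaloisRep`, the private `conjRestrict`) and theorems, all proved; no named
fact, no global instance (D-0026, net debt 0; the orbit fields `k·φ(K)` carry FILE 2's LOCAL `K`-algebra structure).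

## The print, verbatim

J. S. Milne, *The fundamental theorem of complex multiplication*, arXiv:0705.3446 [Milne2007FundamentalCM], §4.2, proof
of PROPOSITION 4.9 (held `paper:arxiv-0705.3446` p0020 L66–L115):

> «`Aut(ℂ/E)Φ_j⁻¹ = Aut(ℂ/E)(σ_j⁻¹Aut(ℂ/E*)) = (Hom_E(L_j,ℂ) ∘ σ_j⁻¹)Aut(ℂ/E*)` where `σ_j` is any element of `Aut(ℂ)` such
> that `σ_j|E ∈ Φ_j` and `L_j = (σ_j⁻¹E*)E`. […] Let `F_j(σ) = ∏_{φ∈Φ_j} w_{σφ}⁻¹ σ w_φ (mod Aut(ℂ/E^ab))`.  We begin by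
> showing that `F_j(σ) = art_E(b_j)`. The basic properties of Artin's reciprocity law show that
> [`𝔸^×_{f,E*} →^{injective} 𝔸^×_{f,σ_jL_j} →^{σ_j⁻¹} 𝔸^×_{f,L_j} →^{Nm_{L_j/E}} 𝔸^×_{f,E}` over
> `Gal(E*^ab/E*) →^{V} σ_jGal(L_j^ab/L_j)σ_j⁻¹ →^{ad σ_j⁻¹} Gal(L_j^ab/L_j) →^{restriction} Gal(E^ab/E)`] commutes.
> Therefore `art_E(b_j)` is the image of `art_{E*}(a)` by the three maps in the bottom row of the diagram. Consider
> `{t_φ | t_φ = w_φσ_j⁻¹, φ ∈ Φ_j}`; this is a set of coset representatives for `σ_jAut(ℂ/L_j)σ_j⁻¹` in `Aut(ℂ/E*)`,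
> and so `F_j(σ) = ∏_{φ∈Φ_j} σ_j⁻¹ t_{σφ}⁻¹ σ t_φ σ_j = σ_j⁻¹V(σ)σ_j mod Aut(ℂ/E^ab)`.»

## Reading (the tree's vocabulary; `Γ_F = absoluteGaloisGroup F`, `res_F^M = absGaloisRestrict F M : Γ_M → Γ_F` along
## the fixed `ι_{F,M} : F̄ → M̄ = absClosureEmbedding F M`, `e_{F,M} = absEmbedding F M : M → F̄`)

As in `…/TateHalfTransferCM`: `G = Γ_ℚ` acts on `X = Γ_ℚ ⧸ H`, `H = res_ℚ^K(Γ_K)` (`= Hom(K, ℂ)`), base point `1·H`,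
`ϕ = absGaloisRangeAbProj ℚ K : H → Γ_K^ab`.  Milne's `Aut(ℂ/E*)` (or `Aut(ℂ/k)` for a number field `k ⊇ E*`, `k ⊂ ℂ`) is
`S = res_ℚ^k(Γ_k) ≤ Γ_ℚ`, ISOMORPHIC to `Γ_k` by `res_ℚ^k`.  An orbit `Φ_j` is an `S`-orbit in `X`; FILE 2 indexes the
orbits by p27's representatives `r ∈ orbitReps … k` and attaches to `r` the field `M_r = k·r(K) ⊂ ℂ` — Milne's `σ_jL_j` —
a `k`-algebra by inclusion and a `K`-algebra THROUGH `r`.  This file attaches to `r` (indeed to any `φ : Emb K`):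

* `orbitEmbedding K k φ : K → Q̄`, `a ↦ ι_{ℚ,k}⁻¹(e_{k,M}(φ a))` — the copy of `K` inside `Q̄` whose composite with `k` is the
  tree's model `e_{k,M}(M)` of `M = k·φ(K)` in `k̄ = Q̄`;
* `orbitGaloisRep K k φ = g ∈ Γ_ℚ` with `g • e_{ℚ,K}(a) = orbitEmbedding a` (Milne's `σ_j`; it exists because `Γ_ℚ` is
  transitive on `Hom(K, Q̄)`, `exists_smul_absEmbedding_eq`), so the point `q = gH ∈ X` is «`σ_j|E`»;

and proves that, along the isomorphism `res_ℚ^k : Γ_k ≅ S`, **the stabiliser `Stab_S(q)` is `res_k^M(Γ_M) ≅ Γ_M`**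
(«`σ_jAut(ℂ/L_j)σ_j⁻¹` in `Aut(ℂ/E*)`» IS `Aut(ℂ/σ_jL_j)`) and **the character `t ↦ ϕ(g⁻¹tg)` of FILE 1 on it is
`res^ab_{K,M} : Γ_M^ab → Γ_K^ab`** (Milne's «`ad σ_j⁻¹`» followed by «restriction»: with `E → σ_jL_j` through `σ_j` the two
maps merge into the restriction along that embedding — the choice of `K`-algebra structure on `M_r` made in FILE 2; that
the tree's restriction `res_K^M`, defined through an unrelated choice of `K̄ → M̄`, computes it is the independence of
restriction maps up to conjugacy, `absGaloisRestrict_isConj_of_algHom_holds`).  Hence FILE 1's transfer formula reads: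

**`∏_{x ∈ S•q} ϕ(w(σx)⁻¹σw(x)) = res^ab_{K,M}(Ver_{M/k}[σ])` for `σ ∈ Γ_k`** — «`F_j(σ) = σ_j⁻¹V(σ)σ_j`» followed by the maps
`ad σ_j⁻¹` and restriction of Milne's bottom row (`finprod_mem_orbit_halfTransferFactor_eq_absGaloisRestrictAb_verlagerung`).

## What is proved

* §1 `exists_smul_absEmbedding_eq`: `Γ_ℚ` is transitive on the embeddings `K → Q̄` (from `…/TateHalfTransferCM`'s
  bijection `Γ_ℚ ⧸ H ≃ Hom(K, ℂ)`).
* §2 `orbitEmbedding`, `orbitGaloisRep` and **(H1) `ι_{k,M}(ι_{ℚ,k}(g • e_{ℚ,K} a)) = (a)_{M̄}`**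
  (`absClosureEmbedding_absClosureEmbedding_orbitGaloisRep_smul`): under the identifications `Q̄ ≅ k̄ → M̄` the translate
  `g • e(K)` is the canonical copy of `K` in `M̄` (through `K → M`).
* §3 `Γ_M` (inside `Γ_ℚ`) fixes `g • e(K)`; `g⁻¹ · res(res γ) · g ∈ H`; and **the subgroup identity**
  `absGaloisRestrict_smul_mk_orbitGaloisRep_eq_iff`: for `δ ∈ Γ_k`, `res_ℚ^k δ` fixes `q = gH` iff `δ ∈ res_k^M(Γ_M)` (⇐ clear;
  ⇒: `δ` then fixes `e_{k,M}` on the generators `φ(K)` of `M = k·φ(K)`, hence on `M`, Mathlib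
  `IntermediateField.algHom_ext_of_eq_adjoin`); as subgroups of `S`: `stabilizer_eq_comap`.
* §4 **Conjugacy**: `γ ↦ res_ℚ^K⁻¹(g⁻¹ res_ℚ^k(res_k^M γ) g) : Γ_M → Γ_K` is compatible with the `K`-embedding
  `y ↦ ι_{k,M}(ι_{ℚ,k}(g • ι_{ℚ,K}⁻¹ y)) : K̄ → M̄`, hence conjugate to `res_K^M` by a fixed element of `Γ_K`
  (`exists_conjRestrict_eq_conj`), so **`ϕ(g⁻¹ res(res γ) g) = res^ab_{K,M}[γ]`** (`absGaloisRangeAbProj_conj_eq`).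
* §5 **`F_j = res^ab ∘ Ver`**: `transfer_orbitTransferHom_eq` — FILE 1's `MonoidHom.transfer (orbitTransferHom ϕ hH S hg) (res σ)`
  equals `absGaloisRestrictAb K M (verlagerung k M [σ])` (flt-inv's transport of Mathlib's transfer along the surjection
  `S ≅ Γ_k`, `transfer_eq_transfer_of_surjective`, and `map_transfer`; row A3-G44's `verlagerung`) — and the orbit form
  `finprod_mem_orbit_halfTransferFactor_eq_absGaloisRestrictAb_verlagerung`.

NOT HERE: the sum over the orbits, the idèles, `N_Φ` (FILE 4); Prop. 4.9 (FILE 5).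

## References

* J. S. Milne, *The fundamental theorem of complex multiplication*, arXiv:0705.3446 (2007), §4.2, Prop. 4.9 (proof).
  [Milne2007FundamentalCM]
* J. Neukirch, *Algebraic Number Theory*, Springer 1999, Ch. IV §5 (the transfer). [NeukirchANT1999]
* J. S. Milne, *Fields and Galois Theory* (v4.60), Ch. 7 (the absolute Galois group is defined up to an inner
  automorphism). [MilneFT2022]

## Provenance

Lane `lit-hodgefound`, seat `literature-prover-lit-hodgefound-skel-3-g30-0` (row A3-G46, FILE 3); consumes BY NAME flt-inv's
`Literature.GroupTheory.Transfer.transfer_eq_transfer_of_surjective` / `map_transfer` (`…/NumberFields/PrincipalIdealTheorem` §0).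
-/

set_option autoImplicit false

noncomputable section

open scoped Pointwise IntermediateField

namespace Literature.NumberTheory.ComplexMultiplication

open Field NumberField
open Literature.NumberTheory.GaloisRepresentations Literature.NumberTheory.NumberFields
open Literature.AlgebraicGeometry.GaoUllmo2025 (Emb)
open Literature.GroupTheory.Transfer (transfer_eq_transfer_of_surjective map_transfer)
open HalfTransfer

attribute [local instance] orbitFieldAlgebra isScalarTower_orbitField moduleFinite_orbitField numberField_orbitField

/- The subgroup `S = res(Γ_k) ≤ Γ_ℚ` must act on `X = Γ_ℚ ⧸ H` through the GENERIC restricted action (`Subgroup.instMulAction`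
of `MulAction.quotient`), the one FILE 1's abstract lemmas instantiate to; Mathlib's special-purpose
`MulAction.mulLeftCosetsCompSubtypeVal : MulAction I (G ⧸ H)` (definitionally but not reducibly equal) would otherwise be
found first and block instance resolution.  Erased locally (this file only). -/
attribute [-instance] MulAction.mulLeftCosetsCompSubtypeVal

/-! ### §1. `Γ_ℚ` is transitive on `Hom(K, Q̄)` -/

section Transitive

variable (K : Type) [Field K] [NumberField K]

/-- `res_ℚ^K : Γ_K → Γ_ℚ` is injective (as a bare monoid homomorphism; the tree's `absGaloisRestrict_injective`, `Q̄ = K̄`).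
[cite: MilneFT2022, Ch. 7 (the absolute Galois group: `Gal(Ω/E) ↪ Gal(Ω/F)` for `F ⊂ E ⊂ Ω`)] -/
theorem toMonoidHom_absGaloisRestrict_rat_injective : Function.Injective (absGaloisRestrict ℚ K).toMonoidHom :=
  fun _ _ h => absGaloisRestrict_injective ℚ K h

/-- **`Γ_ℚ` is transitive on the embeddings `K → Q̄`**: every `ψ : K → Q̄` is `g ∘ e_{ℚ,K}` for some `g ∈ Γ_ℚ` («`σ_j` is
any element of `Aut(ℂ)` such that `σ_j|E ∈ Φ_j`»).  From the bijection `Γ_ℚ ⧸ res(Γ_K) ≃ Hom(K, ℂ)` of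
`…/TateHalfTransferCM` along an embedding `Q̄ → ℂ`. [cite: Milne2007FundamentalCM, §4.2 Prop. 4.9 (proof: «σ_j is any element of Aut(ℂ) such that σ_j|E ∈ Φ_j»)] -/
theorem exists_smul_absEmbedding_eq (ψ : K →+* AlgebraicClosure ℚ) :
    ∃ g : absoluteGaloisGroup ℚ, ∀ a : K, g • (absEmbedding ℚ K a : AlgebraicClosure ℚ) = ψ a := by
  let j : AlgebraicClosure ℚ →+* ℂ :=
    ((@IsAlgClosed.lift ℂ _ _ ℚ _ _ (AlgebraicClosure ℚ) _ _ (AlgebraicClosure.instAlgebra ℚ) _ _ _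
        (AlgebraicClosure.isAlgebraic ℚ) : AlgebraicClosure ℚ →ₐ[ℚ] ℂ) : AlgebraicClosure ℚ →+* ℂ)
  obtain ⟨q, hq⟩ := (embOfCoset_bijective K j).2 (j.comp ψ)
  obtain ⟨g, rfl⟩ := QuotientGroup.mk_surjective q
  refine ⟨g, fun a => j.injective ?_⟩
  have h := RingHom.congr_fun hq a
  rwa [embOfCoset_mk, embOfElement_apply, RingHom.comp_apply] at h

end Transitive

/-! ### §2. The orbit datum: `σ_j ∈ Γ_ℚ` adapted to the model `e_{k,M}(M) ⊆ k̄` of `M = k·φ(K)` -/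

section OrbitData

variable (K : Type) [Field K] [NumberField K] (k : IntermediateField ℚ ℂ) [NumberField k]

/-- **The embedding `K → Q̄`, `a ↦ ι_{ℚ,k}⁻¹(e_{k,M}(φ a))`** (`M = k·φ(K)`): the copy of `K` in `Q̄ = k̄` lying inside the tree's
model `e_{k,M}(M)` of `M`, through `K → M` via `φ` (FILE 2's `orbitFieldAlgebra`). [cite: Milne2007FundamentalCM, §4.2 Prop. 4.9 (proof: «σ_j|E ∈ Φ_j», «L_j = (σ_j⁻¹E*)E»)] -/
def orbitEmbedding (φ : Emb K) : K →+* AlgebraicClosure ℚ :=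
  (((absClosureEquiv ℚ k).symm : AlgebraicClosure k ≃ₐ[ℚ] AlgebraicClosure ℚ) :
      AlgebraicClosure k →+* AlgebraicClosure ℚ).comp
    (((absEmbedding k (orbitField k φ) : orbitField k φ →ₐ[k] AlgebraicClosure k) :
        orbitField k φ →+* AlgebraicClosure k).comp (algebraMap K (orbitField k φ)))

/-- Unfolding. [cite: Milne2007FundamentalCM, §4.2 Prop. 4.9 (proof)] -/
theorem orbitEmbedding_apply (φ : Emb K) (a : K) :
    orbitEmbedding K k φ a =
      (absClosureEquiv ℚ k).symm (absEmbedding k (orbitField k φ) (algebraMap K (orbitField k φ) a)) := rfl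

/-- **Milne's `σ_j`**: an element `g ∈ Γ_ℚ` with `g ∘ e_{ℚ,K} = orbitEmbedding` (a choice; `exists_smul_absEmbedding_eq`).  The
point `gH ∈ Γ_ℚ ⧸ res(Γ_K)` is the embedding «`σ_j|E`» of the orbit. [cite: Milne2007FundamentalCM, §4.2 Prop. 4.9 (proof: «σ_j is any element of Aut(ℂ) such that σ_j|E ∈ Φ_j»)] -/
def orbitGaloisRep (φ : Emb K) : absoluteGaloisGroup ℚ :=
  Classical.choose (exists_smul_absEmbedding_eq K (orbitEmbedding K k φ))

/-- The defining property `g • e_{ℚ,K}(a) = orbitEmbedding a`. [cite: Milne2007FundamentalCM, §4.2 Prop. 4.9 (proof)] -/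
theorem orbitGaloisRep_smul_absEmbedding (φ : Emb K) (a : K) :
    orbitGaloisRep K k φ • (absEmbedding ℚ K a : AlgebraicClosure ℚ) = orbitEmbedding K k φ a :=
  Classical.choose_spec (exists_smul_absEmbedding_eq K (orbitEmbedding K k φ)) a

/-- **(H1') `ι_{ℚ,k}(g • e_{ℚ,K} a) = e_{k,M}(a_M)`**: in `k̄`, the translate `g • e(K)` is the model of `K ⊆ M`.
[cite: Milne2007FundamentalCM, §4.2 Prop. 4.9 (proof)] -/
theorem absClosureEmbedding_orbitGaloisRep_smul (φ : Emb K) (a : K) :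
    absClosureEmbedding ℚ k (orbitGaloisRep K k φ • (absEmbedding ℚ K a : AlgebraicClosure ℚ)) =
      absEmbedding k (orbitField k φ) (algebraMap K (orbitField k φ) a) := by
  rw [orbitGaloisRep_smul_absEmbedding, orbitEmbedding_apply, absClosureEmbedding_absClosureEquiv_symm]

/-- **(H1) `ι_{k,M}(ι_{ℚ,k}(g • e_{ℚ,K} a)) = (a)_{M̄}`**: in `M̄`, the translate `g • e(K)` is the canonical copy of `K` (through
`K → M = k·φ(K)` via `φ`). [cite: Milne2007FundamentalCM, §4.2 Prop. 4.9 (proof)] -/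
theorem absClosureEmbedding_absClosureEmbedding_orbitGaloisRep_smul (φ : Emb K) (a : K) :
    absClosureEmbedding k (orbitField k φ)
        (absClosureEmbedding ℚ k (orbitGaloisRep K k φ • (absEmbedding ℚ K a : AlgebraicClosure ℚ))) =
      algebraMap (orbitField k φ) (AlgebraicClosure (orbitField k φ)) (algebraMap K (orbitField k φ) a) := by
  rw [absClosureEmbedding_orbitGaloisRep_smul, absClosureEmbedding_absEmbedding]

/-- `g • 1·H = gH`. [cite: Milne2007FundamentalCM, §4.2 Prop. 4.9 (proof)] -/
theorem orbitGaloisRep_smul_one :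
    ∀ φ : Emb K, orbitGaloisRep K k φ • (((1 : absoluteGaloisGroup ℚ)) :
        absoluteGaloisGroup ℚ ⧸ (absGaloisRestrict ℚ K).range) =
      ((orbitGaloisRep K k φ : absoluteGaloisGroup ℚ) : absoluteGaloisGroup ℚ ⧸ (absGaloisRestrict ℚ K).range) :=
  fun φ => by rw [MulAction.Quotient.smul_mk, smul_eq_mul, mul_one]

end OrbitData

/-! ### §3. `Γ_M` fixes `g • e(K)`; the stabiliser of `gH` in `Γ_k` is `Γ_M` -/

section Stabiliser

variable (K : Type) [Field K] [NumberField K] (k : IntermediateField ℚ ℂ) [NumberField k]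

/-- **`Γ_M` fixes `g • e(K)`**: for `γ ∈ Γ_M` (`M = k·φ(K)`), `res_ℚ^k(res_k^M γ) • (g • e_{ℚ,K} a) = g • e_{ℚ,K} a` (in `M̄` the
element is `(a)_{M̄}`, fixed by `Aut(M̄/M)`). [cite: Milne2007FundamentalCM, §4.2 Prop. 4.9 (proof: «σ_jAut(ℂ/L_j)σ_j⁻¹»)] -/
theorem absGaloisRestrict_absGaloisRestrict_smul_orbitGaloisRep_smul (φ : Emb K)
    (γ : absoluteGaloisGroup (orbitField k φ)) (a : K) :
    absGaloisRestrict ℚ k (absGaloisRestrict k (orbitField k φ) γ) •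
        (orbitGaloisRep K k φ • (absEmbedding ℚ K a : AlgebraicClosure ℚ)) =
      orbitGaloisRep K k φ • (absEmbedding ℚ K a : AlgebraicClosure ℚ) := by
  apply (absClosureEmbedding ℚ k).toRingHom.injective
  change absClosureEmbedding ℚ k _ = absClosureEmbedding ℚ k _
  rw [absGaloisRestrict_apply_smul]
  apply (absClosureEmbedding k (orbitField k φ)).toRingHom.injective
  change absClosureEmbedding k (orbitField k φ) _ = absClosureEmbedding k (orbitField k φ) _
  rw [absGaloisRestrict_apply_smul, absClosureEmbedding_absClosureEmbedding_orbitGaloisRep_smul,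
    absoluteGaloisGroup.smul_def, AlgEquiv.commutes]

/-- **`g⁻¹ · res(res γ) · g ∈ H = res(Γ_K)`** for `γ ∈ Γ_M` («`σ_j⁻¹ t σ_j ∈ Aut(ℂ/L_j) ⊆ Aut(ℂ/E)` for `t ∈ Aut(ℂ/σ_jL_j)`»).
[cite: Milne2007FundamentalCM, §4.2 Prop. 4.9 (proof)] -/
theorem conj_absGaloisRestrict_mem_range (φ : Emb K) (γ : absoluteGaloisGroup (orbitField k φ)) :
    (orbitGaloisRep K k φ)⁻¹ * absGaloisRestrict ℚ k (absGaloisRestrict k (orbitField k φ) γ) * orbitGaloisRep K k φ ∈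
      (absGaloisRestrict ℚ K).range := by
  rw [mem_range_absGaloisRestrict_iff_smul_absEmbedding]
  intro a
  rw [mul_smul, mul_smul, inv_smul_eq_iff, absGaloisRestrict_absGaloisRestrict_smul_orbitGaloisRep_smul]

/-- **THE STABILISER OF `gH` IN `Γ_k` IS `Γ_M`** («`{t_φ}` … is a set of coset representatives for `σ_jAut(ℂ/L_j)σ_j⁻¹` in
`Aut(ℂ/E*)`», i.e. `Stab_{Aut(ℂ/E*)}(σ_j|E) = Aut(ℂ/σ_jL_j)`): for `δ ∈ Γ_k`, `res_ℚ^k δ` fixes `gH ∈ Γ_ℚ ⧸ res(Γ_K)` iff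
`δ ∈ res_k^M(Γ_M)`, `M = k·φ(K)`.  (⇐: §3.  ⇒: then `δ` fixes `e_{k,M}` on `φ(K)`, which generates `M` over `k`, so `δ`
fixes `e_{k,M}(M)` — Mathlib `IntermediateField.algHom_ext_of_eq_adjoin` — i.e. `δ ∈ res(Γ_M)`,
`mem_range_absGaloisRestrict_iff_smul_absEmbedding`.) [cite: Milne2007FundamentalCM, §4.2 Prop. 4.9 (proof)] -/
theorem absGaloisRestrict_smul_mk_orbitGaloisRep_eq_iff (φ : Emb K) (δ : absoluteGaloisGroup k) :
    absGaloisRestrict ℚ k δ • ((orbitGaloisRep K k φ : absoluteGaloisGroup ℚ) :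
        absoluteGaloisGroup ℚ ⧸ (absGaloisRestrict ℚ K).range) =
      ((orbitGaloisRep K k φ : absoluteGaloisGroup ℚ) : absoluteGaloisGroup ℚ ⧸ (absGaloisRestrict ℚ K).range) ↔
      δ ∈ (absGaloisRestrict k (orbitField k φ)).range := by
  -- `res δ • gH = gH ↔ ∀ a, g • e a = res δ • g • e a`
  have key : absGaloisRestrict ℚ k δ • ((orbitGaloisRep K k φ : absoluteGaloisGroup ℚ) :
        absoluteGaloisGroup ℚ ⧸ (absGaloisRestrict ℚ K).range) =
      ((orbitGaloisRep K k φ : absoluteGaloisGroup ℚ) : absoluteGaloisGroup ℚ ⧸ (absGaloisRestrict ℚ K).range) ↔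
      ∀ a : K, absEmbedding k (orbitField k φ) (algebraMap K (orbitField k φ) a) =
        δ • absEmbedding k (orbitField k φ) (algebraMap K (orbitField k φ) a) := by
    rw [MulAction.Quotient.smul_mk, smul_eq_mul, QuotientGroup.eq, mem_range_absGaloisRestrict_iff_smul_absEmbedding]
    refine forall_congr' fun a => ?_
    rw [mul_inv_rev, mul_smul, mul_smul, inv_smul_eq_iff, inv_smul_eq_iff,
      ← (absClosureEmbedding ℚ k).toRingHom.injective.eq_iff]
    change absClosureEmbedding ℚ k _ = absClosureEmbedding ℚ k _ ↔ _
    rw [absGaloisRestrict_apply_smul, absClosureEmbedding_orbitGaloisRep_smul]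
  rw [key, mem_range_absGaloisRestrict_iff_smul_absEmbedding]
  constructor
  · intro h x
    -- two `k`-algebra maps `M → k̄` agreeing on the generators `φ(K)` of `M = k·φ(K)`
    have hext : ((absoluteGaloisGroup.toAlgEquiv k δ : AlgebraicClosure k ≃ₐ[k] AlgebraicClosure k) :
          AlgebraicClosure k →ₐ[k] AlgebraicClosure k).comp (absEmbedding k (orbitField k φ)) =
        absEmbedding k (orbitField k φ) := by
      refine IntermediateField.algHom_ext_of_eq_adjoin k (S := orbitField k φ) (s := Set.range φ) rfl
        fun z hz => ?_
      obtain ⟨a, rfl⟩ := hz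
      exact (h a).symm
    have hx := DFunLike.congr_fun hext x
    exact hx
  · intro h a
    exact (h _).symm

end Stabiliser

/-! ### §4. Conjugacy: the character `t ↦ ϕ(g⁻¹tg)` on `Γ_M` is `res^ab_{K,M}` -/

section Conjugacy

variable (K : Type) [Field K] [NumberField K] (k : IntermediateField ℚ ℂ) [NumberField k]

/-- `γ ↦ res_ℚ^K⁻¹(g⁻¹ · res(res γ) · g) : Γ_M → Γ_K` — «`ad σ_j⁻¹`» followed by restriction, on elements of `Γ_ℚ`.
[cite: Milne2007FundamentalCM, §4.2 Prop. 4.9 (proof: «ad σ_j⁻¹», «restriction»)] -/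
private def conjRestrict (φ : Emb K) (γ : absoluteGaloisGroup (orbitField k φ)) : absoluteGaloisGroup K :=
  (MonoidHom.ofInjective (toMonoidHom_absGaloisRestrict_rat_injective K)).symm
    ⟨(orbitGaloisRep K k φ)⁻¹ * absGaloisRestrict ℚ k (absGaloisRestrict k (orbitField k φ) γ) * orbitGaloisRep K k φ,
      conj_absGaloisRestrict_mem_range K k φ γ⟩

/-- `res_ℚ^K (conjRestrict γ) = g⁻¹ · res(res γ) · g`. [cite: Milne2007FundamentalCM, §4.2 Prop. 4.9 (proof)] -/
private theorem absGaloisRestrict_conjRestrict (φ : Emb K) (γ : absoluteGaloisGroup (orbitField k φ)) :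
    absGaloisRestrict ℚ K (conjRestrict K k φ γ) =
      (orbitGaloisRep K k φ)⁻¹ * absGaloisRestrict ℚ k (absGaloisRestrict k (orbitField k φ) γ) * orbitGaloisRep K k φ :=
  MonoidHom.apply_ofInjective_symm (toMonoidHom_absGaloisRestrict_rat_injective K) _

/-- **Conjugacy**: `γ ↦ res_ℚ^K⁻¹(g⁻¹ res(res γ) g)` is compatible with the `K`-embedding `K̄ → M̄`,
`y ↦ ι_{k,M}(ι_{ℚ,k}(g • ι_{ℚ,K}⁻¹ y))` (a `K`-algebra map by (H1)), hence — the absolute Galois group being defined up to an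
inner automorphism, `absGaloisRestrict_isConj_of_algHom_holds` — it is `β · res_K^M(·) · β⁻¹` for a fixed `β ∈ Γ_K`.
[cite: Milne2007FundamentalCM, §4.2 Prop. 4.9 (proof)] [cite: MilneFT2022, Ch. 7 (the absolute Galois group is defined up to an inner automorphism)] -/
private theorem exists_conjRestrict_eq_conj (φ : Emb K) :
    ∃ β : absoluteGaloisGroup K, ∀ γ : absoluteGaloisGroup (orbitField k φ),
      conjRestrict K k φ γ = β * absGaloisRestrict K (orbitField k φ) γ * β⁻¹ := by
  -- the ring map `ρ : K̄ → M̄`, `y ↦ ι_{k,M}(ι_{ℚ,k}(g • ι_{ℚ,K}⁻¹ y))`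
  let ρ : AlgebraicClosure K →+* AlgebraicClosure (orbitField k φ) :=
    ((absClosureEmbedding k (orbitField k φ) : AlgebraicClosure k →ₐ[k] AlgebraicClosure (orbitField k φ)) :
        AlgebraicClosure k →+* AlgebraicClosure (orbitField k φ)).comp
      (((absClosureEmbedding ℚ k : AlgebraicClosure ℚ →ₐ[ℚ] AlgebraicClosure k) :
          AlgebraicClosure ℚ →+* AlgebraicClosure k).comp
        ((((absoluteGaloisGroup.toAlgEquiv ℚ (orbitGaloisRep K k φ)) :
              AlgebraicClosure ℚ ≃ₐ[ℚ] AlgebraicClosure ℚ) : AlgebraicClosure ℚ →+* AlgebraicClosure ℚ).comp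
          (((absClosureEquiv ℚ K).symm : AlgebraicClosure K ≃ₐ[ℚ] AlgebraicClosure ℚ) :
            AlgebraicClosure K →+* AlgebraicClosure ℚ)))
  have hρ : ∀ y, ρ y = absClosureEmbedding k (orbitField k φ)
      (absClosureEmbedding ℚ k (orbitGaloisRep K k φ • (absClosureEquiv ℚ K).symm y)) := fun y => rfl
  -- it is `K`-linear by (H1)
  have hρK : ∀ a : K, ρ (algebraMap K (AlgebraicClosure K) a) =
      algebraMap K (AlgebraicClosure (orbitField k φ)) a := fun a => by
    rw [hρ]
    change absClosureEmbedding k (orbitField k φ)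
        (absClosureEmbedding ℚ k (orbitGaloisRep K k φ • (absEmbedding ℚ K a : AlgebraicClosure ℚ))) = _
    rw [absClosureEmbedding_absClosureEmbedding_orbitGaloisRep_smul, ← IsScalarTower.algebraMap_apply]
  let ι' : AlgebraicClosure K →ₐ[K] AlgebraicClosure (orbitField k φ) := { toRingHom := ρ, commutes' := hρK }
  have hι' : ∀ y, ι' y = ρ y := fun y => rfl
  refine absGaloisRestrict_isConj_of_algHom_holds K (orbitField k φ) ι' (conjRestrict K k φ) fun γ y => ?_
  -- compatibility `ι'(r' γ • y) = γ • ι' y`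
  have hy : y = absClosureEmbedding ℚ K ((absClosureEquiv ℚ K).symm y) :=
    (absClosureEmbedding_absClosureEquiv_symm (K := ℚ) (L := K) y).symm
  rw [hι', hι', hy, ← absGaloisRestrict_apply_smul, absGaloisRestrict_conjRestrict, hρ, hρ,
    absClosureEquiv_symm_absClosureEmbedding, absClosureEquiv_symm_absClosureEmbedding, mul_smul, mul_smul,
    smul_inv_smul, absGaloisRestrict_apply_smul, absGaloisRestrict_apply_smul]

omit [NumberField K] in
/-- In the topological abelianisation, conjugate elements have the same class. [folklore] -/
private theorem absGaloisAbProj_conj (β x : absoluteGaloisGroup K) :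
    absGaloisAbProj K (β * x * β⁻¹) = absGaloisAbProj K x := by
  rw [map_mul, map_mul, map_inv, mul_comm (absGaloisAbProj K β) (absGaloisAbProj K x), mul_assoc, mul_inv_cancel,
    mul_one]

/-- **THE CHARACTER `t ↦ ϕ(g⁻¹tg)` ON `Γ_M` IS `res^ab_{K,M}`**: for `γ ∈ Γ_M` and `h = g⁻¹ · res(res γ) · g ∈ H`,
`ϕ(h) = res^ab_{K,M}[γ]` in `Γ_K^ab` (`ϕ = absGaloisRangeAbProj ℚ K`) — Milne's «`ad σ_j⁻¹`» followed by «restriction», computed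
by the tree's restriction `Γ_M^ab → Γ_K^ab` along `K → M = k·φ(K)` through `φ`.
[cite: Milne2007FundamentalCM, §4.2 Prop. 4.9 (proof: «σ_j⁻¹V(σ)σ_j mod Aut(ℂ/E^ab)», «ad σ_j⁻¹», «restriction»)] -/
theorem absGaloisRangeAbProj_conj_eq (φ : Emb K) (γ : absoluteGaloisGroup (orbitField k φ))
    {h : (absGaloisRestrict ℚ K).range}
    (hh : (h : absoluteGaloisGroup ℚ) =
      (orbitGaloisRep K k φ)⁻¹ * absGaloisRestrict ℚ k (absGaloisRestrict k (orbitField k φ) γ) * orbitGaloisRep K k φ) :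
    absGaloisRangeAbProj ℚ K h =
      absGaloisRestrictAb K (orbitField k φ) (absGaloisAbProj (orbitField k φ) γ) := by
  obtain ⟨β, hβ⟩ := exists_conjRestrict_eq_conj K k φ
  rw [absGaloisRangeAbProj_eq_of_eq ((absGaloisRestrict_conjRestrict K k φ γ).trans hh.symm), hβ γ,
    absGaloisAbProj_conj, absGaloisRestrictAb_mk]

end Conjugacy

/-! ### §5. `F_j(σ) = σ_j⁻¹V(σ)σ_j = res^ab_{K,M}(Ver_{M/k}[σ])` -/

section PerOrbit

variable (K : Type) [Field K] [NumberField K] (k : IntermediateField ℚ ℂ) [NumberField k]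

/-- **`Stab_S(gH) = Γ_M` as subgroups of `S = res(Γ_k)`**: under the isomorphism `S ≅ Γ_k` (inverse of `res_ℚ^k`), the
stabiliser of `gH` in `S` is the preimage of `res_k^M(Γ_M) ≤ Γ_k` (§3).
[cite: Milne2007FundamentalCM, §4.2 Prop. 4.9 (proof: «a set of coset representatives for σ_jAut(ℂ/L_j)σ_j⁻¹ in Aut(ℂ/E*)»)] -/
theorem stabilizer_orbitGaloisRep_eq_comap (φ : Emb K) :
    MulAction.stabilizer (absGaloisRestrict ℚ k).range
        ((orbitGaloisRep K k φ : absoluteGaloisGroup ℚ) : absoluteGaloisGroup ℚ ⧸ (absGaloisRestrict ℚ K).range) =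
      ((absGaloisRestrict k (orbitField k φ)).range).comap
        (MonoidHom.ofInjective (toMonoidHom_absGaloisRestrict_rat_injective k)).symm.toMonoidHom := by
  ext u
  obtain ⟨δ, hδ⟩ : ∃ δ : absoluteGaloisGroup k, absGaloisRestrict ℚ k δ = (u : absoluteGaloisGroup ℚ) := u.2
  have hu : u = MonoidHom.ofInjective (toMonoidHom_absGaloisRestrict_rat_injective k) δ := Subtype.ext hδ.symm
  have h1 : u ∈ MulAction.stabilizer (absGaloisRestrict ℚ k).range
      ((orbitGaloisRep K k φ : absoluteGaloisGroup ℚ) : absoluteGaloisGroup ℚ ⧸ (absGaloisRestrict ℚ K).range) ↔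
      absGaloisRestrict ℚ k δ • ((orbitGaloisRep K k φ : absoluteGaloisGroup ℚ) :
        absoluteGaloisGroup ℚ ⧸ (absGaloisRestrict ℚ K).range) =
      ((orbitGaloisRep K k φ : absoluteGaloisGroup ℚ) : absoluteGaloisGroup ℚ ⧸ (absGaloisRestrict ℚ K).range) := by
    rw [MulAction.mem_stabilizer_iff, hδ]
    rfl
  have h2 : u ∈ ((absGaloisRestrict k (orbitField k φ)).range).comap
      (MonoidHom.ofInjective (toMonoidHom_absGaloisRestrict_rat_injective k)).symm.toMonoidHom ↔
      δ ∈ (absGaloisRestrict k (orbitField k φ)).range := by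
    rw [Subgroup.mem_comap, MulEquiv.coe_toMonoidHom, hu, MulEquiv.symm_apply_apply]
  rw [h1, h2]
  exact absGaloisRestrict_smul_mk_orbitGaloisRep_eq_iff K k φ δ

/-- **`F_j(σ) = σ_j⁻¹V(σ)σ_j` READ IN `Gal(E^ab/E)`: the transfer of FILE 1 over the orbit of `gH` equals
`res^ab_{K,M}(Ver_{M/k}[σ])`.**  For `σ ∈ Γ_k` (`M = k·φ(K)` a `K`-algebra through `φ`, `g = orbitGaloisRep`):
`MonoidHom.transfer (orbitTransferHom ϕ hH S hg) (res σ) = absGaloisRestrictAb K M (verlagerung k M [σ])` — transport of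
Mathlib's transfer along `S ≅ Γ_k` (flt-inv's `transfer_eq_transfer_of_surjective`) with §3 (the subgroups correspond) and
§4 (the characters correspond), then `map_transfer` and row A3-G44's `verlagerung` (`= transfer` of `absGaloisRangeAbProj k M`).
[cite: Milne2007FundamentalCM, §4.2 Prop. 4.9 (proof: «F_j(σ) = ∏ σ_j⁻¹t_{σφ}⁻¹σt_φσ_j = σ_j⁻¹V(σ)σ_j mod Aut(ℂ/E^ab)»)]
[cite: NeukirchANT1999, Ch. IV §5 p. 271 (definition of Ver)] -/
theorem transfer_orbitTransferHom_eq (φ : Emb K) (τ : absoluteGaloisGroup k) :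
    @MonoidHom.transfer (absGaloisRestrict ℚ k).range _
        (MulAction.stabilizer (absGaloisRestrict ℚ k).range
          ((orbitGaloisRep K k φ : absoluteGaloisGroup ℚ) : absoluteGaloisGroup ℚ ⧸ (absGaloisRestrict ℚ K).range))
        (absoluteGaloisGroupAbelianization K) _
        (orbitTransferHom (absGaloisRangeAbProj ℚ K)
          (mem_iff_smul_quotient_one_eq (H := (absGaloisRestrict ℚ K).range)) (absGaloisRestrict ℚ k).range
          (orbitGaloisRep_smul_one K k φ))
        (finiteIndex_stabilizer_of_finite (absGaloisRestrict ℚ k).range _)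
        ⟨absGaloisRestrict ℚ k τ, ⟨τ, rfl⟩⟩ =
      absGaloisRestrictAb K (orbitField k φ) (verlagerung k (orbitField k φ) (absGaloisAbProj k τ)) := by
  haveI := finiteIndex_stabilizer_of_finite (absGaloisRestrict ℚ k).range
    ((orbitGaloisRep K k φ : absoluteGaloisGroup ℚ) : absoluteGaloisGroup ℚ ⧸ (absGaloisRestrict ℚ K).range)
  haveI hR : ((absGaloisRestrict k (orbitField k φ)).range).FiniteIndex := Subgroup.finiteIndex_of_finite_quotient
  -- the isomorphism `f : S ≅ Γ_k`
  let e := MonoidHom.ofInjective (toMonoidHom_absGaloisRestrict_rat_injective k)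
  have he : ∀ δ : absoluteGaloisGroup k, ((e δ : (absGaloisRestrict ℚ k).range) : absoluteGaloisGroup ℚ) =
      absGaloisRestrict ℚ k δ := fun δ => MonoidHom.ofInjective_apply _
  -- the character `res^ab ∘ ϕ_{k,M}` on `Γ_M ≤ Γ_k`
  let ψQ : (absGaloisRestrict k (orbitField k φ)).range →* absoluteGaloisGroupAbelianization K :=
    (absGaloisRestrictAb K (orbitField k φ)).toMonoidHom.comp (absGaloisRangeAbProj k (orbitField k φ))
  have hτ : (⟨absGaloisRestrict ℚ k τ, ⟨τ, rfl⟩⟩ : (absGaloisRestrict ℚ k).range) = e τ := Subtype.ext (he τ).symm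
  rw [hτ, transfer_eq_transfer_of_surjective e.symm.toMonoidHom e.symm.surjective
    (absGaloisRestrict k (orbitField k φ)).range (stabilizer_orbitGaloisRep_eq_comap K k φ) ψQ _ ?_ (e τ)]
  · rw [MulEquiv.coe_toMonoidHom, MulEquiv.symm_apply_apply, verlagerung_absGaloisAbProj, absGaloisTransfer]
    exact (map_transfer (absGaloisRangeAbProj k (orbitField k φ))
      (absGaloisRestrictAb K (orbitField k φ)).toMonoidHom τ).symm
  -- the characters correspond (§4)
  intro u
  obtain ⟨γ, hγ⟩ : e.symm.toMonoidHom (u : (absGaloisRestrict ℚ k).range) ∈ (absGaloisRestrict k (orbitField k φ)).range :=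
    (stabilizer_orbitGaloisRep_eq_comap K k φ).le u.2
  have hγ' : absGaloisRestrict k (orbitField k φ) γ = e.symm (u : (absGaloisRestrict ℚ k).range) := hγ
  have hu : ((u : (absGaloisRestrict ℚ k).range) : absoluteGaloisGroup ℚ) =
      absGaloisRestrict ℚ k (absGaloisRestrict k (orbitField k φ) γ) := by
    rw [hγ']
    exact (MonoidHom.apply_ofInjective_symm (toMonoidHom_absGaloisRestrict_rat_injective k) _).symm
  rw [orbitTransferHom_apply, absGaloisRangeAbProj_conj_eq K k φ γ (by
    change (orbitGaloisRep K k φ)⁻¹ * ((u : (absGaloisRestrict ℚ k).range) : absoluteGaloisGroup ℚ) *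
      orbitGaloisRep K k φ = _
    rw [hu])]
  change _ = absGaloisRestrictAb K (orbitField k φ) (absGaloisRangeAbProj k (orbitField k φ) _)
  rw [absGaloisRangeAbProj_eq_of_eq hγ']

/-- **`F_j(σ) = res^ab_{K,M}(Ver_{M/k}[σ])` — the product over the orbit.**  For `σ ∈ Γ_k`, ANY section `w` of `X → Γ_ℚ` and the
`S`-orbit of `gH`: `∏_{x ∈ S•gH} ϕ(w(σx)⁻¹ σ w(x)) = absGaloisRestrictAb K M (verlagerung k M [σ])` (FILE 1's orbit formula
and `transfer_orbitTransferHom_eq`).  The class in `Γ_K^ab` Milne writes `F_j(σ) = σ_j⁻¹V(σ)σ_j mod Aut(ℂ/E^ab)`.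
[cite: Milne2007FundamentalCM, §4.2 Prop. 4.9 (proof: «F_j(σ) = σ_j⁻¹V(σ)σ_j»)] -/
theorem finprod_mem_orbit_halfTransferFactor_eq_absGaloisRestrictAb_verlagerung (φ : Emb K)
    {w : absoluteGaloisGroup ℚ ⧸ (absGaloisRestrict ℚ K).range → absoluteGaloisGroup ℚ}
    (hw : ∀ x, w x • (((1 : absoluteGaloisGroup ℚ)) : absoluteGaloisGroup ℚ ⧸ (absGaloisRestrict ℚ K).range) = x)
    (τ : absoluteGaloisGroup k) :
    ∏ᶠ x ∈ MulAction.orbit (absGaloisRestrict ℚ k).range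
        ((orbitGaloisRep K k φ : absoluteGaloisGroup ℚ) : absoluteGaloisGroup ℚ ⧸ (absGaloisRestrict ℚ K).range),
      absGaloisRangeAbProj ℚ K
        (halfTransferFactor (mem_iff_smul_quotient_one_eq (H := (absGaloisRestrict ℚ K).range)) hw
          (absGaloisRestrict ℚ k τ) x) =
      absGaloisRestrictAb K (orbitField k φ) (verlagerung k (orbitField k φ) (absGaloisAbProj k τ)) := by
  rw [← transfer_orbitTransferHom_eq K k φ τ]
  exact finprod_mem_orbit_eq_transfer (absGaloisRangeAbProj ℚ K)
    (mem_iff_smul_quotient_one_eq (H := (absGaloisRestrict ℚ K).range)) (absGaloisRestrict ℚ k).range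
    (orbitGaloisRep_smul_one K k φ) hw ⟨absGaloisRestrict ℚ k τ, ⟨τ, rfl⟩⟩

end PerOrbit

end Literature.NumberTheory.ComplexMultiplication

end
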